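import Summits.Ventures.HSemireg.WedgeHankelRecurrenceGaussChebyshevMonotoneLeftHalfLine

/-!
# Venture HSemireg — **POWER GROWTH OFF THE INTERVAL: for `x ≥ 1`, `xⁿ ≤ T_n(x) ≤ 2^{n−1}xⁿ` (`n ≥ 1`) and `(n+1)xⁿ ≤ U_n(x) ≤ (2x)ⁿ`; for `x ≥ 2`, `2(x∕2)ⁿ ≤ C_n(x) ≤ xⁿ` (`n ≥ 1`) and
# `(n+1)(x∕2)ⁿ ≤ S_n(x) ≤ xⁿ`** (two-sided comparison of the Chebyshev ∕ Vieta–Lucas polynomials with their leading monomials on the right half-line)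

HONEST FRAMING. Part of the Lean index of the computation cell `pub-hsemireg` (seat p10 gen 49, Sunday typer «UNIFORM-IN-n»).  Real polynomial inequalities only (Mathlib `Polynomial.Chebyshev.T ∕ U ∕
C ∕ S` over `ℝ`); no variety, no cohomology theory, no sheaf, no Ext group and no semiregularity map is constructed here; nothing here says that HC / HC_CM / HC_AV holds; no Literature fact
(unproved `Prop`) is declared or used.  Custodian versions as in `WedgeHankelSiegelIdeal` (1/3).
SOURCES (cited).  T. J. Rivlin, *The Chebyshev Polynomials* (Wiley 1974), §1.2, §2.7 (growth outside `[−1, 1]`, leading coefficients `2^{n−1}`, `2ⁿ`); J. C. Mason, D. C. Handscomb, *Chebyshev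
Polynomials* (2003), §1.4; NIST DLMF §18.9 (three-term recurrences).
PROOF TYPED HERE.  (1) `T_{n+2} = X·T_{n+1} − (1 − X²)U_n` (Mathlib `T_eq_X_mul_T_sub_pol_U`) with `U_n(x) ≥ 0` (N521) gives `T_{n+2}(x) ≥ x·T_{n+1}(x)`, hence `T_n(x) ≥ xⁿ`; (2) `T_{n+2} = 2X·T_{n+1} − T_n` with
`T_n ≥ 1` gives `2T_n(x) ≤ (2x)ⁿ`; (3) `U_{m+1} = X·U_m + T_{m+1}` (`Literature…U_natCast_succ`) and (1) give `U_n(x) ≥ (n+1)xⁿ`; `U_{n+2} = 2X·U_{n+1} − U_n` with `U_n ≥ 0` gives `U_n(x) ≤ (2x)ⁿ`;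
(4) `S_n(x) = U_n(x∕2)`, `C_n(x) = 2T_n(x∕2)` (N521).
DEDUP DISCLOSURE (`rg -n 'x \\^ n ≤ \\(.*Chebyshev|eval x ≤ x \\^ n|eval x ≤ 2 \\^' Summits/Ventures/HSemireg Literature Mathlib…Chebyshev`, 2026-09-04): Mathlib has `one_le_eval_T_real`, `leadingCoeff_T`,
the extremal statements of `Chebyshev/Extremal.lean` on `[−1, 1]`, and N521 ∕ N522 the constant lower bounds and monotonicity; related but different in the tree: `Literature.Algebra.Polynomial.ChebyshevExplicitForms.
chebyshevT_real_eval_eq_half_add_pow` (the exact `T_n(x) = ((x+√(x²−1))ⁿ + (x−√(x²−1))ⁿ)∕2`, `|x| ≥ 1`), `…ChebyshevShiftedMinimax.half_pow_le_eval_T` (`½((√κ+1)∕(√κ−1))^k ≤ T_k((κ+1)∕(κ−1))`) and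
`…ChebyshevSubmultiplicative.abs_eval_T_real_le ∕ eval_T_mul_le` (all cited, none used: the first module imports all of Mathlib, the other two results are not needed below); no comparison
with `xⁿ` itself; 0 hits for the 8 names below.

WHAT IS IN THE TREE.  N521 `le_eval_chebyshevU_real`, `chebyshevS_eval_eq_U_eval_half`, `chebyshevC_eval_eq_two_mul_T_eval_half`; `Literature…FitznerVanDerHofstad2017.U_natCast_succ`; Mathlib
`T_eq_X_mul_T_sub_pol_U`, `T_add_two`, `U_add_two`, `T_two`, `one_le_eval_T_real`.
THIS FILE (namespace `Summit.Ventures.HSemireg.Wedge.HankelOuter` continued; CHAINED on N531; 0 definitions):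
* §1297 **`pow_le_eval_chebyshevT_real`** (`xⁿ ≤ T_n(x)`), **`two_mul_eval_chebyshevT_real_le_pow`** (`2T_n(x) ≤ (2x)ⁿ`, `n ≠ 0`), **`mul_pow_le_eval_chebyshevU_real`** (`(n+1)xⁿ ≤ U_n(x)`),
  **`eval_chebyshevU_real_le_pow`** (`U_n(x) ≤ (2x)ⁿ`) — all for `x ≥ 1`; **`mul_pow_le_eval_chebyshevS_real`** (`(n+1)(x∕2)ⁿ ≤ S_n(x)`), **`eval_chebyshevS_real_le_pow`** (`S_n(x) ≤ xⁿ`),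
  **`two_mul_pow_le_eval_chebyshevC_real`** (`2(x∕2)ⁿ ≤ C_n(x)`), **`eval_chebyshevC_real_le_pow`** (`C_n(x) ≤ xⁿ`, `n ≠ 0`) — all for `x ≥ 2`.
CAVEATS.  Equality throughout at `n = 1` (and at `x = 1` resp. `x = 2` for the lower bounds).  Nothing Ext-side.  New names only.
-/

open Module Polynomial
open scoped Matrix Polynomial

namespace Summit.Ventures.HSemireg.Wedge.HankelOuter

/-! ## §1297. Comparison with the leading monomial on the right half-line -/

/-- **`xⁿ ≤ T_n(x)` for `x ≥ 1`** (`T_{n+2} = xT_{n+1} + (x² − 1)U_n ≥ xT_{n+1}`). [Rivlin 1974, §1.2; this file, §1297] -/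
theorem pow_le_eval_chebyshevT_real (n : ℕ) {x : ℝ} (hx : 1 ≤ x) : x ^ n ≤ (Polynomial.Chebyshev.T ℝ (n : ℤ)).eval x := by
  induction n using Nat.twoStepInduction with
  | zero => simp
  | one => simp
  | more n ih0 ih1 =>
    rw [show ((n + 2 : ℕ) : ℤ) = (n : ℤ) + 2 by push_cast; ring, Polynomial.Chebyshev.T_eq_X_mul_T_sub_pol_U, show (n : ℤ) + 1 = ((n + 1 : ℕ) : ℤ) by push_cast; ring]
    simp only [eval_sub, eval_mul, eval_X, eval_one, eval_pow]
    have hU : (0 : ℝ) ≤ (Polynomial.Chebyshev.U ℝ (n : ℤ)).eval x := by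
      have h1 := le_eval_chebyshevU_real n hx
      have h2 := Nat.cast_nonneg (α := ℝ) n
      linarith
    have hx0 : (0 : ℝ) ≤ x := by linarith
    have hx2 : (0 : ℝ) ≤ x ^ 2 - 1 := by nlinarith
    nlinarith [mul_le_mul_of_nonneg_left ih1 hx0, mul_nonneg hx2 hU, pow_succ x (n + 1)]

/-- **`2T_n(x) ≤ (2x)ⁿ` for `x ≥ 1` and `n ≠ 0`**, i.e. `T_n(x) ≤ 2^{n−1}xⁿ` (`T_{n+2} = 2xT_{n+1} − T_n` with `T_n ≥ 1`). [Rivlin 1974, §1.2; this file, §1297] -/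
theorem two_mul_eval_chebyshevT_real_le_pow {n : ℕ} (hn : n ≠ 0) {x : ℝ} (hx : 1 ≤ x) : 2 * (Polynomial.Chebyshev.T ℝ (n : ℤ)).eval x ≤ (2 * x) ^ n := by
  obtain ⟨m, rfl⟩ : ∃ m, n = m + 1 := ⟨n - 1, by omega⟩
  clear hn
  induction m using Nat.twoStepInduction with
  | zero => simp
  | one =>
    simp [Polynomial.Chebyshev.T_two]
    nlinarith
  | more m ih0 ih1 =>
    rw [show ((m + 2 + 1 : ℕ) : ℤ) = ((m + 1 : ℕ) : ℤ) + 2 by push_cast; ring, Polynomial.Chebyshev.T_add_two,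
      show ((m + 1 : ℕ) : ℤ) + 1 = ((m + 1 + 1 : ℕ) : ℤ) by push_cast; ring]
    simp only [eval_sub, eval_mul, eval_ofNat, eval_X]
    have hT := Polynomial.Chebyshev.one_le_eval_T_real ((m + 1 : ℕ) : ℤ) hx
    have h2x : (0 : ℝ) ≤ 2 * x := by linarith
    nlinarith [mul_le_mul_of_nonneg_left ih1 h2x, pow_succ (2 * x) (m + 1 + 1)]

/-- **`(n+1)xⁿ ≤ U_n(x)` for `x ≥ 1`** (`U_{m+1} = xU_m + T_{m+1}`, `T_{m+1} ≥ x^{m+1}`). [Rivlin 1974, §1.2; this file, §1297] -/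
theorem mul_pow_le_eval_chebyshevU_real (n : ℕ) {x : ℝ} (hx : 1 ≤ x) : ((n : ℝ) + 1) * x ^ n ≤ (Polynomial.Chebyshev.U ℝ (n : ℤ)).eval x := by
  induction n with
  | zero => simp
  | succ m ih =>
    rw [Literature.Probability.FitznerVanDerHofstad2017.U_natCast_succ, eval_add, eval_mul, eval_X, Nat.cast_succ (R := ℝ)]
    have hT := pow_le_eval_chebyshevT_real (m + 1) hx
    have hx0 : (0 : ℝ) ≤ x := by linarith
    nlinarith [mul_le_mul_of_nonneg_left ih hx0, pow_succ x m]

/-- **`U_n(x) ≤ (2x)ⁿ` for `x ≥ 1`** (`U_{n+2} = 2xU_{n+1} − U_n` with `U_n ≥ 0`). [Rivlin 1974, §1.2; this file, §1297] -/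
theorem eval_chebyshevU_real_le_pow (n : ℕ) {x : ℝ} (hx : 1 ≤ x) : (Polynomial.Chebyshev.U ℝ (n : ℤ)).eval x ≤ (2 * x) ^ n := by
  induction n using Nat.twoStepInduction with
  | zero => simp
  | one => simp
  | more n ih0 ih1 =>
    rw [show ((n + 2 : ℕ) : ℤ) = (n : ℤ) + 2 by push_cast; ring, Polynomial.Chebyshev.U_add_two, show (n : ℤ) + 1 = ((n + 1 : ℕ) : ℤ) by push_cast; ring]
    simp only [eval_sub, eval_mul, eval_ofNat, eval_X]
    have hU : (0 : ℝ) ≤ (Polynomial.Chebyshev.U ℝ (n : ℤ)).eval x := by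
      have h1 := le_eval_chebyshevU_real n hx
      have h2 := Nat.cast_nonneg (α := ℝ) n
      linarith
    have h2x : (0 : ℝ) ≤ 2 * x := by linarith
    nlinarith [mul_le_mul_of_nonneg_left ih1 h2x, pow_succ (2 * x) (n + 1)]

/-! ### `S_n` and `C_n` on `[2, ∞)` -/

/-- **`(n+1)(x∕2)ⁿ ≤ S_n(x)` for `x ≥ 2`.** [Rivlin 1974, §1.2; this file, §1297] -/
theorem mul_pow_le_eval_chebyshevS_real (n : ℕ) {x : ℝ} (hx : 2 ≤ x) : ((n : ℝ) + 1) * (x / 2) ^ n ≤ (Polynomial.Chebyshev.S ℝ (n : ℤ)).eval x := by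
  rw [chebyshevS_eval_eq_U_eval_half]
  exact mul_pow_le_eval_chebyshevU_real n (by linarith)

/-- **`S_n(x) ≤ xⁿ` for `x ≥ 2`** (`S_n` is monic with all roots in `(−2, 2)`). [Rivlin 1974, §1.2; this file, §1297] -/
theorem eval_chebyshevS_real_le_pow (n : ℕ) {x : ℝ} (hx : 2 ≤ x) : (Polynomial.Chebyshev.S ℝ (n : ℤ)).eval x ≤ x ^ n := by
  rw [chebyshevS_eval_eq_U_eval_half]
  have h := eval_chebyshevU_real_le_pow n (show (1 : ℝ) ≤ x / 2 by linarith)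
  rwa [show 2 * (x / 2) = x by ring] at h

/-- **`2(x∕2)ⁿ ≤ C_n(x)` for `x ≥ 2`.** [Rivlin 1974, §1.2; this file, §1297] -/
theorem two_mul_pow_le_eval_chebyshevC_real (n : ℕ) {x : ℝ} (hx : 2 ≤ x) : 2 * (x / 2) ^ n ≤ (Polynomial.Chebyshev.C ℝ (n : ℤ)).eval x := by
  rw [chebyshevC_eval_eq_two_mul_T_eval_half]
  have h := pow_le_eval_chebyshevT_real n (show (1 : ℝ) ≤ x / 2 by linarith)
  linarith

/-- **`C_n(x) ≤ xⁿ` for `x ≥ 2` and `n ≠ 0`** (`C_n` is monic with all roots in `(−2, 2)`; `C_0 = 2`). [Rivlin 1974, §1.2; this file, §1297] -/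
theorem eval_chebyshevC_real_le_pow {n : ℕ} (hn : n ≠ 0) {x : ℝ} (hx : 2 ≤ x) : (Polynomial.Chebyshev.C ℝ (n : ℤ)).eval x ≤ x ^ n := by
  rw [chebyshevC_eval_eq_two_mul_T_eval_half]
  have h := two_mul_eval_chebyshevT_real_le_pow hn (show (1 : ℝ) ≤ x / 2 by linarith)
  rwa [show 2 * (x / 2) = x by ring] at h

end Summit.Ventures.HSemireg.Wedge.HankelOuter
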